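import Summits.BirchSwinnertonDyer.BirchSwinnertonDyer.Theorems.MordellShaFreeCutOfHeegnerNonTorsion
import Summits.BirchSwinnertonDyer.BirchSwinnertonDyer.Theorems.CongruentShaFreeCutKatoZetaRoad
import HarnessLib

/-!
# Route `MordellShaFreeCut` (rung S2b) — crux B `AnalyticRankOneOfRankOneFiniteShaThree`
# (stmt-BirchSwinnertonDyer-19160) on the KATO–ZETA ROAD of Burungale–Skinner (appendix to
# Alpöge–Bhargava–Shnidman, arXiv:2210.10730, Thm. 10.1) and Burungale–Tian (Ann. of Math. 203
# (2026), Thm. 2.6): the S2b twin of `Theorems/CongruentShaFreeCutKatoZetaRoad.lean`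

Cell `bsd-cn100`, prover seat `bsd-cn100-s2-c3` (g6), SERVICE filing for the S2b twin. Supports, does
not close, stmt-BirchSwinnertonDyer-19160. THEOREMS ONLY — no definition, no named fact, nothing
asserted. HONEST FRAMING: nothing here proves crux B of S2b, the leaf `rankOne_threeConverse_mordellCurve`,
Sylvester's problem or any case of BSD. PARTITION: none — RANK axis.

The object: the Mordell curves `E_D : y² = x³ + D` (`j = 0`, CM by `ℤ[ω]`, `3` RAMIFIED in `ℚ(√−3)`);
every elliptic `W/ℚ` with `j = 0` has ADDITIVE (potentially good) reduction at `3`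
(`v₃(Δ) ≡ 3 + 2 v₃(D) (mod 12)` is odd for the short model, and `v₃(Δ) mod 12` is model-independent),
so crux B of S2b = «`rank E_D(ℚ) = 1 ∧ #Ш(E_D)[3^∞] < ∞ ⟹ ord_{s=1} L(E_D,s) = 1`» is, like its S2
twin, Burungale–Skinner's Thm. 10.1 at an additive prime of a CM curve. The road and its sources are
described in `CongruentShaFreeCutKatoZetaRoad.lean` (Burungale–Skinner App. A §10.1.3: Kato's main
conjecture in `Λ ⊗ ℚ` for CM curves at every prime = Burungale–Tian 2026 Thm. 2.6 [PRINT] + Kato's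
Thm. 12.4/12.5/§14.14 and (14.9.3) [PRINT] + Perrin-Riou's conjecture Thm. 10.8 [printed at GOOD
supersingular primes only: Burungale–Kobayashi–Ota JIMJ 2024, Kobayashi 2013]); this file only
instantiates the ∀-closed bridge `CongruentShaFreeCutKatoZetaRoad.analyticRank_eq_one_of_katoZetaRoad`
on the class `𝒞 W := (W.j = 0)` at `p = 3` and descends to every `D ≠ 0` by the landed
`MordellShaFreeCutOfHeegnerNonTorsion.stub_minimalModelReduction` (Néron's global minimal model).

* `cruxB_of_katoZetaRoad` — crux B of S2b BY NAME from: Kato finiteness at `3` (tree fact), (R) a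
  Kato descent datum of `T₃W` exists for every globally minimal `W` with `j = 0` [PRINT], (3.1')
  `rank 1 ∧ #Ш[3^∞] < ∞ ⟹ H2/TH2` finite [PRINT], (K) Kato's Conj. 12.10 in `Λ ⊗ ℚ₃` for the CM newform
  `f_W` on every realised datum [Burungale–Tian 2026 Thm. 2.6: PRINT], and ONE research reading
  (PR₃) Perrin-Riou's conjecture for `(W, 3)`, `j(W) = 0`, in consumed form [OPEN at the additive
  prime `3`; Alpöge–Bhargava–Shnidman §2: «If the theorem of Burungale–Skinner is eventually
  generalized to cover any CM elliptic curve with potentially supersingular reduction …»].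
* `cruxB_iff_perrinRiouReading_of_readings` — modulo the print readings, crux B of S2b and (PR₃)
  are one statement.

References: [AlpogeBhargavaShnidman2022] App. A Thm. 10.1, Rem. 10.5 (i), Thm. 10.6, Thm. 10.8,
§10.1.3; §2 after Thm. 2.10. [BurungaleTian2026] Thm. 2.6, p. 2. [Kato2004Asterisque] Thm. 12.4,
Thm. 12.5, Conj. 12.10, (14.9.3) (p. 240), §14.14 (p. 243), Cor. 14.3.
-/

set_option autoImplicit false
set_option linter.dupNamespace false

noncomputable section

open scoped Classical

open WeierstrassCurve Literature.NumberTheory.EllipticCurves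
  Literature.NumberTheory.EllipticCurves.Rank1Residual
  Summit.BirchSwinnertonDyer.Rank1Residual.Additive
  Summit.BirchSwinnertonDyer.BirchSwinnertonDyer.Theses.MordellShaFreeCut

namespace Summit.BirchSwinnertonDyer.BirchSwinnertonDyer.Theorems.MordellShaFreeCutKatoZetaRoad

variable {IsOf : ∀ (W : WeierstrassCurve ℚ) [W.IsElliptic] [W.IsGloballyMinimal] (p : ℕ)
  [Fact p.Prime], KatoDescentDatum p → Prop}

/-- **Crux B `AnalyticRankOneOfRankOneFiniteShaThree` (stmt-BirchSwinnertonDyer-19160) on the Kato–zeta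
road** (Burungale–Skinner App. A, Thm. 10.1 run at the ADDITIVE prime `3` of the `j = 0` curves).
Displayed hypotheses, read for every GLOBALLY MINIMAL elliptic `W/ℚ` with `j(W) = 0`, at `p = 3`:
`hKato` — Kato's finiteness theorem (tree fact `kato_finite_of_L_one_ne_zero`); (R) `hR` — a Kato
descent datum of `T₃W` over the cyclotomic `ℤ₃`-extension exists [Kato Thm. 12.4 (1)(2), Thm. 12.5 (2),
§14.14; PRINT]; (3.1') `h31` — `rank W(ℚ) = 1 ∧ #Ш(W)[3^∞] < ∞ ⟹ H2/TH2 = H²(ℤ[1/3], T₃W)` finite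
[Kato (14.9.3) + (14.14.2) with `Sel_st` finite in rank one; Burungale–Skinner §10.1.3; PRINT]; (K)
`hMC` — Kato's Main Conjecture 12.10 in `Λ ⊗ ℚ₃` for the CM newform `f_W` on every realised datum
[Burungale–Tian, Ann. of Math. 203 (2026) Thm. 2.6: PRINT]; (PR₃) `hPR` — **THE research statement of
this road**: Perrin-Riou's conjecture for `(W, 3)` in the form §10.1.3 consumes it — `rank 1`,
`#Ш[3^∞] < ∞`, `L(W,1) = 0` and `ι(z̄)` not `ℤ₃`-torsion in `H¹(ℤ[1/3], T₃W)` ⟹ `ord_{s=1} L(W,s) = 1`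
[Burungale–Skinner Thm. 10.8, printed only at GOOD supersingular primes; OPEN here]. Descent to
every `D ≠ 0` by `MordellShaFreeCutOfHeegnerNonTorsion.stub_minimalModelReduction` (landed; Néron's
global minimal model; `j`, rank, `Ш[3^∞]`, `ord L` invariant). CONDITIONAL on the displayed
hypotheses; credits nothing beyond this composition.
[cite: AlpogeBhargavaShnidman2022, App. A Thm. 10.1, Rem. 10.5 (i), Thm. 10.6, Thm. 10.8, §10.1.3; §2 after Thm. 2.10]
[cite: BurungaleTian2026, Thm. 2.6 and p. 2] [cite: Kato2004Asterisque, Thm. 12.4, Thm. 12.5, Conj. 12.10, (14.9.3), §14.14, Cor. 14.3] -/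
theorem cruxB_of_katoZetaRoad
    (hKato : ∀ (W : WeierstrassCurve ℚ) [W.IsElliptic], kato_finite_of_L_one_ne_zero W 3)
    (hR : ∀ (W : WeierstrassCurve ℚ) [W.IsElliptic] [W.IsGloballyMinimal],
      W.j = 0 → ∃ D : KatoDescentDatum 3, IsOf W 3 D)
    (h31 : ∀ (W : WeierstrassCurve ℚ) [W.IsElliptic] [W.IsGloballyMinimal] (D : KatoDescentDatum 3),
      W.j = 0 → IsOf W 3 D → W.mordellWeilRank = 1 →
        Finite (AddCommGroup.primaryComponent W.sha 3) → Finite (IwasawaAlgebra.coinvariants 3 D.H2))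
    (hMC : ∀ (W : WeierstrassCurve ℚ) [W.IsElliptic] [W.IsGloballyMinimal] (D : KatoDescentDatum 3),
      W.j = 0 → IsOf W 3 D → ∃ a b : ℕ,
        Ideal.span {((3 : ℕ) : IwasawaAlgebra 3) ^ a} * Module.charIdeal (IwasawaAlgebra 3) D.H2 =
          Ideal.span {((3 : ℕ) : IwasawaAlgebra 3) ^ b} *
            Module.charIdeal (IwasawaAlgebra 3) (D.H ⧸ (IwasawaAlgebra 3) ∙ D.z))
    (hPR : ∀ (W : WeierstrassCurve ℚ) [W.IsElliptic] [W.IsGloballyMinimal] (D : KatoDescentDatum 3),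
      W.j = 0 → IsOf W 3 D → W.mordellWeilRank = 1 →
        Finite (AddCommGroup.primaryComponent W.sha 3) → W.entireLFunction 1 = 0 →
          (∀ m : ℕ, 3 ^ m • D.ι (Submodule.Quotient.mk D.z) ≠ 0) → W.analyticRank = 1) :
    AnalyticRankOneOfRankOneFiniteShaThree := by
  refine MordellShaFreeCutOfHeegnerNonTorsion.stub_minimalModelReduction ?_
  intro W _ _ hj hrank hsha
  -- the engine's class predicate is instance-free: `j = 0 ⟺ c₄ = 0` for an elliptic curve
  exact CongruentShaFreeCutKatoZetaRoad.analyticRank_eq_one_of_katoZetaRoad (𝒞 := fun W => W.c₄ = 0)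
    hKato (fun W _ _ hc => hR W (W.j_eq_zero_iff.mpr hc))
    (fun W _ _ D hc hD => h31 W D (W.j_eq_zero_iff.mpr hc) hD)
    (fun W _ _ D hc hD => hMC W D (W.j_eq_zero_iff.mpr hc) hD)
    (fun W _ _ D hc hD => hPR W D (W.j_eq_zero_iff.mpr hc) hD) W (W.j_eq_zero_iff.mp hj) hrank hsha

/-- **On the Kato–zeta road crux B of S2b and (PR₃) are one statement modulo print** (⟸ is
`cruxB_of_katoZetaRoad`; ⟹: every globally minimal `W` with `j = 0` is a change of variables of a
Mordell curve, `MordellShaFreeCutOfHeegnerNonTorsion.exists_variableChange_eq_mordellCurve_of_j_eq_zero`,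
and rank, `Ш[3^∞]`, `ord L` are invariant). The main-conjecture input of a rank-one `3`-converse for the
`j = 0` curves is print (Burungale–Tian 2026 Thm. 2.6); the research content of crux B is exactly
Perrin-Riou's conjecture, consumed form, at the additive prime `3` — a LOCALISATION, not a weakening.
[cite: AlpogeBhargavaShnidman2022, App. A Thm. 10.1 and §10.1.3; §2 after Thm. 2.10] [cite: BurungaleTian2026, Thm. 2.6] -/
theorem cruxB_iff_perrinRiouReading_of_readings
    (hKato : ∀ (W : WeierstrassCurve ℚ) [W.IsElliptic], kato_finite_of_L_one_ne_zero W 3)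
    (hR : ∀ (W : WeierstrassCurve ℚ) [W.IsElliptic] [W.IsGloballyMinimal],
      W.j = 0 → ∃ D : KatoDescentDatum 3, IsOf W 3 D)
    (h31 : ∀ (W : WeierstrassCurve ℚ) [W.IsElliptic] [W.IsGloballyMinimal] (D : KatoDescentDatum 3),
      W.j = 0 → IsOf W 3 D → W.mordellWeilRank = 1 →
        Finite (AddCommGroup.primaryComponent W.sha 3) → Finite (IwasawaAlgebra.coinvariants 3 D.H2))
    (hMC : ∀ (W : WeierstrassCurve ℚ) [W.IsElliptic] [W.IsGloballyMinimal] (D : KatoDescentDatum 3),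
      W.j = 0 → IsOf W 3 D → ∃ a b : ℕ,
        Ideal.span {((3 : ℕ) : IwasawaAlgebra 3) ^ a} * Module.charIdeal (IwasawaAlgebra 3) D.H2 =
          Ideal.span {((3 : ℕ) : IwasawaAlgebra 3) ^ b} *
            Module.charIdeal (IwasawaAlgebra 3) (D.H ⧸ (IwasawaAlgebra 3) ∙ D.z)) :
    AnalyticRankOneOfRankOneFiniteShaThree ↔
      ∀ (W : WeierstrassCurve ℚ) [W.IsElliptic] [W.IsGloballyMinimal] (D : KatoDescentDatum 3),
        W.j = 0 → IsOf W 3 D → W.mordellWeilRank = 1 →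
          Finite (AddCommGroup.primaryComponent W.sha 3) → W.entireLFunction 1 = 0 →
            (∀ m : ℕ, 3 ^ m • D.ι (Submodule.Quotient.mk D.z) ≠ 0) → W.analyticRank = 1 := by
  constructor
  · intro hB W _ _ D hj _ hrank hsha _ _
    -- `W ≅ E_d` over `ℚ` (short normal form with `c₄ = 0`), `d ≠ 0`
    obtain ⟨C, d, hCD⟩ :=
      MordellShaFreeCutOfHeegnerNonTorsion.exists_variableChange_eq_mordellCurve_of_j_eq_zero W hj
    haveI hE : (mordellCurve d).IsElliptic := by rw [← hCD]; infer_instance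
    have hd : d ≠ 0 := by
      intro hd0
      have hΔ : (mordellCurve d).Δ ≠ 0 := by
        rw [← WeierstrassCurve.coe_Δ']; exact (mordellCurve d).Δ'.ne_zero
      rw [mordellCurve_Δ, hd0] at hΔ
      norm_num at hΔ
    -- crux B on `E_d`, transported back to `W`
    have hr' : (mordellCurve d).mordellWeilRank = 1 := by
      rw [← hCD, mordellWeilRank_variableChange_holds]; exact hrank
    haveI := hsha
    have hfin' : Finite (AddCommGroup.primaryComponent (mordellCurve d).sha 3) := by
      rw [← hCD]; exact WeierstrassCurve.finite_primaryComponent_sha_variableChange W C 3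
    have h := hB hd hr' hfin'
    rwa [← hCD, analyticRank_variableChange_holds W C] at h
  · exact cruxB_of_katoZetaRoad hKato hR h31 hMC

end Summit.BirchSwinnertonDyer.BirchSwinnertonDyer.Theorems.MordellShaFreeCutKatoZetaRoad

end
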